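import Summits.Ventures.HodgeRepro.FacePattern

/-!
# Single-class quadruples from a Klein subgroup need `|G| ≥ 24`

Blind re-derivation cell `pub-hodge-repro`, seat `p1` (gen 6).  The companion of
`CyclicCosetThreshold.lean` for the OTHER subgroup of order `4`: if the four twists
`Φ, Φa, Φb, Φab` of a CM type by a Klein subgroup `Δ = {1, a, b, ab}` not containing `c` form a
`SumTwo` quadruple without a conjugate pair, then `|G| ≥ 24` (`twentyfour_le_card_of_kleinQuad`).
Python control: the first instances appear at `|G| = 24` (`C₆ × C₂ × C₂`: 192, all of pattern
`(4,4,4)`; `proofs/p1-g6/klein24.out`).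

Proof.  With `S_u = Φ ∩ Φu` (typer's `shared`), `|S_a| + |S_b| + |S_{ab}| = |Φ|`
(`sum_card_shared`); no conjugate pair gives `S_u ≠ ∅` (`conj_of_shared_eq_empty`); and from
`y ∈ S_u` — i.e. `y, yu ∈ Φ`, hence `yv, yw ∉ Φ` for the other two elements `v, w` of `Δ ∖ {1}`
(`SumTwo` at `y`), hence `c yv, c yw ∈ Φ` — the FOUR elements `y, yu, c yv, c yw` lie in `S_u`
(`four_le_card_inter_rmul_of_klein`), so `|Φ| ≥ 12`.
-/

set_option autoImplicit false

open Finset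
open scoped Pointwise

namespace HodgeRepro

variable {G : Type*} [Group G]

/-- The quadruple of twists of `Φ` by the Klein group `{1, a, b, ab}`. -/
def kleinQuad (Φ : Finset G) (a b : G) : Fin 4 → Finset G :=
  ![Φ, rmul Φ a, rmul Φ b, rmul Φ (a * b)]

/-- The first corner of `kleinQuad`. -/
theorem kleinQuad_zero (Φ : Finset G) (a b : G) : kleinQuad Φ a b 0 = Φ := rfl

/-- The second corner of `kleinQuad`. -/
theorem kleinQuad_one (Φ : Finset G) (a b : G) : kleinQuad Φ a b 1 = rmul Φ a := rfl

/-- The third corner of `kleinQuad`. -/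
theorem kleinQuad_two (Φ : Finset G) (a b : G) : kleinQuad Φ a b 2 = rmul Φ b := rfl

/-- The fourth corner of `kleinQuad`. -/
theorem kleinQuad_three (Φ : Finset G) (a b : G) : kleinQuad Φ a b 3 = rmul Φ (a * b) := rfl

/-- Every corner of `kleinQuad` of a CM type is a CM type. -/
theorem isCMType_kleinQuad {c : G} {Φ : Finset G} (hΦ : IsCMType c Φ) (a b : G) (i : Fin 4) :
    IsCMType c (kleinQuad Φ a b i) := by
  fin_cases i
  · exact hΦ
  · exact hΦ.rmul a
  · exact hΦ.rmul b
  · exact hΦ.rmul (a * b)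

variable [DecidableEq G]

/-- **The core count.**  Let `u, v, w` be the three non-trivial elements of a Klein subgroup not
containing `c` (`u² = v² = 1`, `uv = vu = w`) and `y ∈ Φ` with `yu ∈ Φ`, `yv ∉ Φ`, `yw ∉ Φ`.  Then
`y, yu, c yv, c yw` are four distinct elements of `Φ ∩ Φu`. -/
theorem four_le_card_inter_rmul_of_klein {c : G} (hc : IsComplexConj c) {Φ : Finset G}
    (hΦ : IsCMType c Φ) {u v w : G} (hu : u * u = 1) (hv : v * v = 1) (huv : u * v = w)
    (hvu : v * u = w) (hu1 : u ≠ 1) (hcv : c ≠ v) (hcw : c ≠ w) (hcuv : c * v ≠ u) (hcw1 : c * w ≠ u)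
    {y : G} (hy : y ∈ Φ) (hyu : y * u ∈ Φ) (hyv : y * v ∉ Φ) (hyw : y * w ∉ Φ) :
    4 ≤ (Φ ∩ rmul Φ u).card := by
  have huinv : u⁻¹ = u := inv_eq_of_mul_eq_one_right hu
  have hwu : w * u = v := by rw [← hvu, mul_assoc, hu, mul_one]
  have hcen : ∀ z t : G, c * (z * t) = z * (c * t) := by
    intro z t; rw [← mul_assoc, hc.comm, mul_assoc]
  have mem : ∀ x, x ∈ Φ ∩ rmul Φ u ↔ x ∈ Φ ∧ x * u ∈ Φ := by
    intro x; rw [mem_inter, mem_rmul, huinv]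
  have e1 : y ∈ Φ ∩ rmul Φ u := (mem y).2 ⟨hy, hyu⟩
  have e2 : y * u ∈ Φ ∩ rmul Φ u := by
    rw [mem, mul_assoc, hu, mul_one]; exact ⟨hyu, hy⟩
  have e3 : c * (y * v) ∈ Φ ∩ rmul Φ u := by
    rw [mem, mul_assoc, mul_assoc, hvu]
    exact ⟨(hΦ.conj_mem_iff _).2 hyv, (hΦ.conj_mem_iff _).2 hyw⟩
  have e4 : c * (y * w) ∈ Φ ∩ rmul Φ u := by
    rw [mem, mul_assoc, mul_assoc, hwu]
    exact ⟨(hΦ.conj_mem_iff _).2 hyw, (hΦ.conj_mem_iff _).2 hyv⟩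
  -- distinctness
  have d12 : y ≠ y * u := fun h => hu1 (mul_eq_left.1 h.symm)
  have d13 : y ≠ c * (y * v) := by
    intro h
    rw [hcen, eq_comm, mul_eq_left] at h
    exact hcv ((eq_inv_of_mul_eq_one_right h).trans hc.inv_eq).symm
  have d14 : y ≠ c * (y * w) := by
    intro h
    rw [hcen, eq_comm, mul_eq_left] at h
    exact hcw ((eq_inv_of_mul_eq_one_right h).trans hc.inv_eq).symm
  have d23 : y * u ≠ c * (y * v) := by
    intro h
    rw [hcen, mul_left_cancel_iff] at h
    exact hcuv h.symm
  have d24 : y * u ≠ c * (y * w) := by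
    intro h
    rw [hcen, mul_left_cancel_iff] at h
    exact hcw1 h.symm
  have d34 : c * (y * v) ≠ c * (y * w) := by
    intro h
    rw [mul_left_cancel_iff, mul_left_cancel_iff] at h
    apply hu1
    have h' : v * v = w * v := by rw [← h]
    rw [hv, ← hvu, mul_assoc, huv, ← hvu, ← mul_assoc, hv, one_mul] at h'
    exact h'.symm
  have hsub : ({y, y * u, c * (y * v), c * (y * w)} : Finset G) ⊆ Φ ∩ rmul Φ u := by
    intro x hx
    simp only [mem_insert, mem_singleton] at hx
    rcases hx with rfl | rfl | rfl | rfl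
    · exact e1
    · exact e2
    · exact e3
    · exact e4
  have hcard : ({y, y * u, c * (y * v), c * (y * w)} : Finset G).card = 4 := by
    rw [card_insert_of_notMem, card_insert_of_notMem, card_pair d34]
    · simp only [mem_insert, mem_singleton, not_or]
      exact ⟨d23, d24⟩
    · simp only [mem_insert, mem_singleton, not_or]
      exact ⟨d12, d13, d14⟩
  have := Finset.card_le_card hsub
  rwa [hcard] at this

variable [Fintype G]

/-- **A Klein-subgroup single-class quadruple without a conjugate pair needs `|G| ≥ 24`.** -/
theorem twentyfour_le_card_of_kleinQuad {c : G} (hc : IsComplexConj c) {Φ : Finset G}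
    (hΦ : IsCMType c Φ) {a b : G} (ha : a * a = 1) (hb : b * b = 1) (hab : a * b = b * a)
    (ha1 : a ≠ 1) (hb1 : b ≠ 1) (hab1 : a ≠ b) (hca : c ≠ a) (hcb : c ≠ b) (hcab : c ≠ a * b)
    (hs : SumTwo (kleinQuad Φ a b))
    (hnc : ∀ i j : Fin 4, kleinQuad Φ a b j ≠ c • kleinQuad Φ a b i) : 24 ≤ Fintype.card G := by
  have hT : ∀ i, IsCMType c (kleinQuad Φ a b i) := isCMType_kleinQuad hΦ a b
  have hainv : a⁻¹ = a := inv_eq_of_mul_eq_one_right ha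
  have hbinv : b⁻¹ = b := inv_eq_of_mul_eq_one_right hb
  have habab : a * b * (a * b) = 1 := by
    rw [mul_assoc, ← mul_assoc b a b, ← hab, mul_assoc, hb, mul_one, ha]
  have habinv : (a * b)⁻¹ = a * b := inv_eq_of_mul_eq_one_right habab
  have hab1' : a * b ≠ 1 := by
    intro h
    exact hab1 ((eq_inv_of_mul_eq_one_left h).trans hbinv)
  -- membership in the corners
  have mem0 : ∀ x, x ∈ kleinQuad Φ a b 0 ↔ x ∈ Φ := fun x => Iff.rfl
  have mem1 : ∀ x, x ∈ kleinQuad Φ a b 1 ↔ x * a ∈ Φ := by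
    intro x; rw [kleinQuad_one, mem_rmul, hainv]
  have mem2 : ∀ x, x ∈ kleinQuad Φ a b 2 ↔ x * b ∈ Φ := by
    intro x; rw [kleinQuad_two, mem_rmul, hbinv]
  have mem3 : ∀ x, x ∈ kleinQuad Φ a b 3 ↔ x * (a * b) ∈ Φ := by
    intro x; rw [kleinQuad_three, mem_rmul, habinv]
  -- an embedding of `Φ` lies in exactly one other corner
  have partner : ∀ x, x ∈ Φ → ∀ e : Fin 4, e ≠ 0 → x ∈ kleinQuad Φ a b e →
      ∀ i : Fin 4, i ≠ 0 → i ≠ e → x ∉ kleinQuad Φ a b i := by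
    intro x hx e he hxe i hi hie hxi
    obtain ⟨e', -, he'⟩ := hs.exists_partner ((mem0 x).2 hx)
    exact hie (((he' i hi).1 hxi).trans ((he' e he).1 hxe).symm)
  -- the shared sets are the intersections
  have hsh1 : shared (kleinQuad Φ a b) 1 = Φ ∩ rmul Φ a := rfl
  have hsh2 : shared (kleinQuad Φ a b) 2 = Φ ∩ rmul Φ b := rfl
  have hsh3 : shared (kleinQuad Φ a b) 3 = Φ ∩ rmul Φ (a * b) := rfl
  have hsum := sum_card_shared hs
  rw [kleinQuad_zero, hsh1, hsh2, hsh3] at hsum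
  -- the three intersections are non-empty
  have h1ne : (Φ ∩ rmul Φ a).Nonempty := by
    rw [Finset.nonempty_iff_ne_empty]
    intro h
    exact hnc 2 3 (conj_of_shared_eq_empty hc hT hs (a := 1) (b := 2) (d := 3)
      (by decide) (by decide) (by decide) (by decide) (by decide) (by decide) h)
  have h2ne : (Φ ∩ rmul Φ b).Nonempty := by
    rw [Finset.nonempty_iff_ne_empty]
    intro h
    exact hnc 1 3 (conj_of_shared_eq_empty hc hT hs (a := 2) (b := 1) (d := 3)
      (by decide) (by decide) (by decide) (by decide) (by decide) (by decide) h)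
  have h3ne : (Φ ∩ rmul Φ (a * b)).Nonempty := by
    rw [Finset.nonempty_iff_ne_empty]
    intro h
    exact hnc 1 2 (conj_of_shared_eq_empty hc hT hs (a := 3) (b := 1) (d := 2)
      (by decide) (by decide) (by decide) (by decide) (by decide) (by decide) h)
  -- the inequalities `c v ≠ u` for the three labellings
  have hcba : c * b ≠ a := by
    intro h
    apply hcab
    rw [← h, mul_assoc, hb, mul_one]
  have hcaba : c * (a * b) ≠ a := by
    intro h
    apply hcb
    have h' : c * (a * b) * b = a * b := by rw [h]
    rwa [mul_assoc, mul_assoc, hb, mul_one, hc.comm, mul_left_cancel_iff] at h'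
  have hcab' : c * a ≠ b := by
    intro h
    apply hcab
    rw [← h, hc.comm, ← mul_assoc, ha, one_mul]
  have hcabb : c * (a * b) ≠ b := by
    intro h
    apply hca
    have h' : c * (a * b) * b = b * b := by rw [h]
    rwa [mul_assoc, mul_assoc, hb, mul_one, mul_eq_one_iff_eq_inv, hainv] at h'
  have hcaab : c * a ≠ a * b := by
    intro h
    apply hcb
    have h' : a * (c * a) = a * (a * b) := by rw [h]
    rwa [← mul_assoc, ← hc.comm, mul_assoc, ha, mul_one, ← mul_assoc, ha, one_mul] at h'
  have hcbab : c * b ≠ a * b := by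
    intro h
    apply hca
    have h' : c * b * b = a * b * b := by rw [h]
    rwa [mul_assoc, hb, mul_one, mul_assoc, hb, mul_one] at h'
  -- each intersection has at least four elements
  have h1 : 4 ≤ (Φ ∩ rmul Φ a).card := by
    obtain ⟨y, hy⟩ := h1ne
    rw [mem_inter, mem_rmul, hainv] at hy
    have hy2 := partner y hy.1 1 (by decide) ((mem1 y).2 hy.2) 2 (by decide) (by decide)
    have hy3 := partner y hy.1 1 (by decide) ((mem1 y).2 hy.2) 3 (by decide) (by decide)
    rw [mem2] at hy2
    rw [mem3] at hy3
    exact four_le_card_inter_rmul_of_klein hc hΦ ha hb rfl hab.symm ha1 hcb hcab hcba hcaba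
      hy.1 hy.2 hy2 hy3
  have h2 : 4 ≤ (Φ ∩ rmul Φ b).card := by
    obtain ⟨y, hy⟩ := h2ne
    rw [mem_inter, mem_rmul, hbinv] at hy
    have hy1 := partner y hy.1 2 (by decide) ((mem2 y).2 hy.2) 1 (by decide) (by decide)
    have hy3 := partner y hy.1 2 (by decide) ((mem2 y).2 hy.2) 3 (by decide) (by decide)
    rw [mem1] at hy1
    rw [mem3] at hy3
    exact four_le_card_inter_rmul_of_klein hc hΦ hb ha hab.symm rfl hb1 hca hcab hcab' hcabb
      hy.1 hy.2 hy1 hy3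
  have h3 : 4 ≤ (Φ ∩ rmul Φ (a * b)).card := by
    obtain ⟨y, hy⟩ := h3ne
    rw [mem_inter, mem_rmul, habinv] at hy
    have hy1 := partner y hy.1 3 (by decide) ((mem3 y).2 hy.2) 1 (by decide) (by decide)
    have hy2 := partner y hy.1 3 (by decide) ((mem3 y).2 hy.2) 2 (by decide) (by decide)
    rw [mem1] at hy1
    rw [mem2] at hy2
    have hw1 : a * b * a = b := by rw [hab, mul_assoc, ha, mul_one]
    have hw2 : a * (a * b) = b := by rw [← mul_assoc, ha, one_mul]
    exact four_le_card_inter_rmul_of_klein hc hΦ habab ha hw1 hw2 hab1' hca hcb hcaab hcbab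
      hy.1 hy.2 hy1 hy2
  have h2m := hΦ.two_mul_card hc
  omega

end HodgeRepro
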